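import Mathlib.NumberTheory.Real.Irrational
import Literature.NumberTheory.ConnesConsani.ArithmeticSiteReducedSquare
import HarnessLib

/-!
# Connes–Consani, *Geometry of the arithmetic site* (2016), §6.3 (middle): Remark 6.14, best
# rational approximations, Lemma 6.15, Prop. 6.16 and eq. (64)
# (`𝒞_λ = lim_{n/m → λ} 𝒞_1 ∘ Fr_{n,m}`) — PROVED

Topic `Literature/NumberTheory/ConnesConsani`. Source: A. Connes, C. Consani, *Geometry of the
arithmetic site*, Adv. Math. 291 (2016) 274–329 = arXiv:1502.05580 [bib
`ConnesConsani2016ArithmeticSite`], §6.3 "The Frobenius correspondences on `𝒜`", Remark 6.14 –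
Prop. 6.16 and eq. (64); arXiv pages p0021–p0022. Sequel of `FrobeniusComposition.lean` (`ℛ(λ) =
frobSemiring λ`, `ℓ(λ) = frobEll`, `r(λ) = frobR`, `Ψ(λ) = frobCorrespondence`, `Iso`),
`ArithmeticSiteSquare.lean` (`ℤ_min ⊗_𝔹 ℤ_min = SubZ2`, `μ = mu`, `Fr_{n,m} = frobNM`,
`ℱ(λ,q) = frobF`, Prop. 6.12 (iii)) and `ArithmeticSiteReducedSquare.lean` (`frobExp`,
`frobF_eq_texp`, `frob_injective`, `zminToT_injective`).

## The statements, verbatim (Adv. Math. numbering)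

* **Remark 6.14.** "Notice that the parameter `λ ∈ ℝ₊*` is uniquely specified by the pair of semiring
  homomorphisms `ℓ : ℤ_min → R`, `r : ℤ_min → R`, where `ℓ(q^n) = q^{nλ}` and `r(q^n) = q^n`, while `R`
  is the semiring generated by `ℓ(ℤ_min)r(ℤ_min)` which does not depend upon the choice of
  `q ∈ (0,1)`. Indeed, as above one obtains the Dedekind cut which defines `λ` by comparing the
  powers of `X = q^λ` and `Y = q`." Then: "The congruence `x ∼ y ⟺ ℱ(λ,q)(x) = ℱ(λ,q)(y)` (62) […]
  is independent of `q`. It is important to note that this congruence can be obtained on any finite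
  subset `Z ⊂ ℤ_min ⊗_𝔹 ℤ_min` by approximating `λ` by rational values `λ' ∈ ℚ₊*`. Indeed, recall
  that a best rational approximation to a real number `λ` is a rational number `n/d`, `d > 0`, that
  is closer to `λ` than any approximation with a smaller or equal denominator."
* **Lemma 6.15.** "Let `λ ∈ ℝ₊*` and `n/d` be a best rational approximation of `λ`. Then replacing
  `λ` by `n/d` does not change the following sets of rational numbers
  `D_-(λ,d) := {b/a ∣ b/a < λ, a < d}`, `D_+(λ,d) := {b/a ∣ b/a > λ, a < d}`." (Proof: "Since the
  interval between `λ` and `n/d` does not contain any rational number `b/a` with `a < d` one gets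
  the equality `D_-(λ,d) = D_-(n/d,d)`.")
* **Proposition 6.16.** "Let `λ ∈ ℝ₊*` be irrational and `x, y ∈ ℤ_min ⊗_𝔹 ℤ_min`. Then one has
  `ℱ(λ,q)(x) = ℱ(λ,q)(y)` if and only if for all sufficiently good approximations `n/m ∼ λ` one has
  `μ ∘ Fr_{n,m}(x) = μ ∘ Fr_{n,m}(y)` where `μ : ℤ_min ⊗_𝔹 ℤ_min → ℤ_min` is the semiring
  multiplication." (Proof: "`ℱ(λ,q)(x) = ℱ(λ,q)(y) ⟺ inf(λn_i + m_i) = inf(λr_i + s_i)`. Let then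
  `n/d` be a best rational approximation of `λ` with `d > sup{n_i, r_i}`. We show that the equality
  `inf(λn_i + m_i) = inf(λr_i + s_i)` is unaffected if one replaces `λ` by `n/d`. […] it is enough
  to show that for any positive integers `a, a', b, b'` with `a < d`, `a' < d`, one has
  `aλ + b < a'λ + b' ⟺ an/d + b < a'n/d + b'`. This amounts to show that the comparison of
  `(a - a')λ` with `b' - b` is unaffected when one replaces `λ` by `n/d` which follows from Lemma
  6.15.") And: "for each `λ ∈ ℝ₊*`, not in `ℚ₊*`, the congruence relation `𝒞_λ` on `ℕ̄ ⊗_𝔹 ℕ̄`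
  defined by (62) is in fact the limit of the `𝒞_r`, as the rational `r → λ` and in turns the
  congruence `𝒞_r` for `r = n/m` is simply given by composing the endomorphism `Fr_{n,m}` with the
  diagonal relation `𝒞_1` which corresponds to the product `μ` in the semiring `ℤ_min`. Thus one can
  write `𝒞_λ = lim_{n/m → λ} 𝒞_1 ∘ Fr_{n,m}` (64)."

## Rendering

* "best rational approximation" = `IsBestApprox λ n d` (`n ∈ ℤ`, `d ∈ ℕ`): `0 < d` and
  `|λ - n/d| < |λ - b/a|` for every pair `(a, b) ≠ (d, n)` with `0 < a ≤ d` (strict, as printed: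
  "closer than ANY approximation with a smaller or equal denominator"; this forces `n/d` to be in
  lowest terms). `D_∓(λ,d)` = `Dminus`/`Dplus` (subsets of `ℚ` of the `b/a`, `0 < a < d`). "For all
  sufficiently good approximations `n/m ∼ λ`" = for all best rational approximations `n/d` of `λ`
  with `d > d₀` (some `d₀` depending on `x, y`); for `λ > 0` these have `n ∈ ℕ`, so `Fr_{n,d}` is
  the companion file's `frobNM n d`. The "pair `(ℓ, r)` up to the choice of `q`" of Remark 6.14 is
  the reduced correspondence `Ψ(λ) = frobCorrespondence λ` up to `ReducedCorrespondence.Iso`.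
* What is PROVED: **Remark 6.14** `ConnesConsani2016_remark_6_14` (`Ψ(λ) ≅ Ψ(λ') ⟹ λ = λ'`, through
  the Dedekind cut `frobEll_add_frobR_eq_iff`: `ℓ(q^a) ⊕ r(q^b) = r(q^b) ⟺ b ≤ aλ`, and
  `not_lt_of_cut`); **Lemma 6.15** `IsBestApprox.lt_iff` (pointwise) and
  `ConnesConsani2016_lemma_6_15` (the two set equalities); **Prop. 6.16**
  `IsBestApprox.cmp_iff` ("`aλ + b < a'λ + b' ⟺ an/d + b < a'n/d + b'`" for `|a - a'| < d`),
  `mu_frobNM_eq_iff` (`𝒞_1 ∘ Fr_{n,m} = 𝒞_{n/m}`, from Prop. 6.12 (iii)),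
  `frobF_eq_iff_of_isBestApprox`, `ConnesConsani2016_prop_6_16` (∃ `d₀`, for all best
  approximations `n/d`, `d > d₀`: `ℱ(λ,q)(x) = ℱ(λ,q)(y) ⟺ μ ∘ Fr_{n,d}(x) = μ ∘ Fr_{n,d}(y)`; valid
  for every `λ ≥ 0`), `exists_isBestApprox_of_irrational`/`exists_isBestApprox_nat` (irrational
  numbers have best approximations with arbitrarily large denominator — the content of
  "sufficiently good approximations" exist), `ConnesConsani2016_prop_6_16_iff` (the printed "if and
  only if", `λ > 0` irrational); **eq. (64)** `ConnesConsani2016_eq_64` (`𝒞_λ = 𝒞_{n/d}` on `{x, y}`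
  for all sufficiently good best approximations).
* Deviations from the printed PROOF (statements as printed): the reduction "after multiplying `x`
  and `y` by `q^k ⊗ q^k` […] we can assume that `x, y ∈ ℕ̄ ⊗_𝔹 ℕ̄⁺`" with `d > sup{n_i, r_i}` is
  replaced by the bound `d > 2 ∑ |n_i|` over the canonical decompositions, which gives directly what
  the argument uses (`|a - a'| < d` for any two first exponents); the transfer of the equality of
  infima along order-equivalent linear forms is `inf'_eq_inf'_iff_of_cmp`. The existence of best
  approximations with large denominators (taken for granted in the text) is proved by finite
  minimisation over the candidates `(a, ⌊λa⌋), (a, ⌈λa⌉)`, `a ≤ D` (`approxCands`), least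
  denominator among the closest, irrationality excluding ties.
-/
noncomputable section

open Set Tropical

namespace Literature.NumberTheory.ConnesConsani

local notation "𝕋" => RMaxExp
local notation "ℕ̄" => ZMinPlus

open SubZ2

/-! ## Remark 6.14: `λ` is uniquely specified by the pair `(ℓ(λ), r(λ))` -/

/-- In `ℛ(λ)`: `ℓ(λ)(q^a) ⊕ r(λ)(q^b) = r(λ)(q^b) ⟺ b ≤ aλ` — "comparing the powers of `X = q^λ` and
`Y = q`" (`X^a ⊕ Y^b = Y^b` iff `q^{aλ} ≤ q^b`). [cite: ConnesConsani2016ArithmeticSite, Remark 6.14 and Prop. 6.13 (proof of (iii))] -/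
theorem frobEll_add_frobR_eq_iff {l : ℝ} (hl : 0 < l) (a b : ℕ) :
    frobEll l hl (nexp a) + frobR l (nexp b) = frobR l (nexp b) ↔ (b : ℝ) ≤ a * l := by
  rw [← Subtype.coe_inj, Subsemiring.coe_add, coe_frobEll_nexp, coe_frobR_nexp, texp_add, texp_inj,
    min_eq_right_iff]

/-- The Dedekind-cut step: if `b ≤ aλ' ⟹ b ≤ aλ` for all `a, b ∈ ℕ` then `¬ λ < λ'`.
[cite: ConnesConsani2016ArithmeticSite, Remark 6.14 ("one obtains the Dedekind cut which defines `λ`")] -/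
theorem not_lt_of_cut {l l' : ℝ} (hl : 0 ≤ l) (H : ∀ a b : ℕ, (b : ℝ) ≤ a * l' → (b : ℝ) ≤ a * l) :
    ¬ l < l' := by
  intro hlt
  have hsub : 0 < l' - l := sub_pos.2 hlt
  obtain ⟨a, ha⟩ := exists_nat_gt (1 / (l' - l))
  have ha1 : 1 < (a : ℝ) * (l' - l) := by rwa [div_lt_iff₀ hsub] at ha
  have hfl := Nat.floor_le (mul_nonneg (Nat.cast_nonneg a) hl)
  have hlt' := Nat.lt_floor_add_one ((a : ℝ) * l)
  have key := H a (⌊(a : ℝ) * l⌋₊ + 1) (by push_cast; linarith)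
  push_cast at key
  linarith

/-- **Connes–Consani 2016, Remark 6.14**: "the parameter `λ ∈ ℝ₊*` is uniquely specified by the pair
of semiring homomorphisms `ℓ : ℤ_min → R`, `r : ℤ_min → R`, where `ℓ(q^n) = q^{nλ}` and `r(q^n) = q^n`,
while `R` is the semiring generated by `ℓ(ℤ_min)r(ℤ_min)` which does not depend upon the choice of
`q ∈ (0,1)`. Indeed, as above one obtains the Dedekind cut which defines `λ` by comparing the powers
of `X = q^λ` and `Y = q`." Rendered: isomorphic Frobenius correspondences `Ψ(λ) ≅ Ψ(λ')` (an
isomorphism `ℛ(λ) ≃ ℛ(λ')` intertwining `ℓ, r`) have `λ = λ'`. [cite: ConnesConsani2016ArithmeticSite, Remark 6.14] -/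
theorem ConnesConsani2016_remark_6_14 {l l' : ℝ} (hl : 0 < l) (hl' : 0 < l')
    (h : (frobCorrespondence l hl).Iso (frobCorrespondence l' hl')) : l = l' := by
  obtain ⟨e, he, hr⟩ := h
  have H : ∀ a b : ℕ, ((b : ℝ) ≤ a * l ↔ (b : ℝ) ≤ a * l') := fun a b => by
    rw [← frobEll_add_frobR_eq_iff hl, ← frobEll_add_frobR_eq_iff hl', ← e.injective.eq_iff, map_add]
    have h1 : e (frobEll l hl (nexp a)) = frobEll l' hl' (nexp a) := he _
    have h2 : e (frobR l (nexp b)) = frobR l' (nexp b) := hr _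
    rw [h1, h2]
  by_contra hne
  rcases lt_or_gt_of_ne hne with hlt | hlt
  · exact not_lt_of_cut hl.le (fun a b => (H a b).2) hlt
  · exact not_lt_of_cut hl'.le (fun a b => (H a b).1) hlt

/-! ## Best rational approximations and Lemma 6.15 -/

/-- "a best rational approximation to a real number `λ` is a rational number `n/d`, `d > 0`, that is
closer to `λ` than any approximation with a smaller or equal denominator" (any other pair `(a, b)`,
`0 < a ≤ d`, gives `|λ - n/d| < |λ - b/a|`). [cite: ConnesConsani2016ArithmeticSite, §6.3 (before Lemma 6.15)] -/
def IsBestApprox (l : ℝ) (n : ℤ) (d : ℕ) : Prop :=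
  0 < d ∧ ∀ (b : ℤ) (a : ℕ), 0 < a → a ≤ d → (a, b) ≠ (d, n) → |l - n / d| < |l - b / a|

/-- `d > 0`. [cite: ConnesConsani2016ArithmeticSite, §6.3 (before Lemma 6.15)] -/
theorem IsBestApprox.pos {l : ℝ} {n : ℤ} {d : ℕ} (h : IsBestApprox l n d) : 0 < d := h.1

/-- **Lemma 6.15, pointwise**: for `a < d`, `b/a < λ ⟺ b/a < n/d` and `b/a > λ ⟺ b/a > n/d` ("the
interval between `λ` and `n/d` does not contain any rational number `b/a` with `a < d`").
[cite: ConnesConsani2016ArithmeticSite, Lemma 6.15 (proof)] -/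
theorem IsBestApprox.lt_iff {l : ℝ} {n : ℤ} {d : ℕ} (h : IsBestApprox l n d) {a : ℕ} (ha : 0 < a)
    (had : a < d) (b : ℤ) :
    ((b : ℝ) / a < l ↔ (b : ℝ) / a < n / d) ∧ (l < b / a ↔ (n : ℝ) / d < b / a) := by
  have key := h.2 b a ha had.le (fun e => absurd (congrArg Prod.fst e) had.ne)
  refine ⟨⟨fun h1 => ?_, fun h1 => ?_⟩, ⟨fun h1 => ?_, fun h1 => ?_⟩⟩ <;> by_contra h2 <;> push Not at h2
  · rw [abs_of_nonneg (by linarith : (0 : ℝ) ≤ l - n / d), abs_of_pos (by linarith : (0 : ℝ) < l - b / a)] at key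
    linarith
  · rw [abs_of_neg (by linarith : l - n / d < 0), abs_of_nonpos (by linarith : l - b / a ≤ 0)] at key
    linarith
  · rw [abs_of_nonpos (by linarith : l - n / d ≤ 0), abs_of_neg (by linarith : l - b / a < 0)] at key
    linarith
  · rw [abs_of_pos (by linarith : 0 < l - n / d), abs_of_nonneg (by linarith : 0 ≤ l - b / a)] at key
    linarith

/-- `D_-(λ,d) := {b/a ∣ b/a < λ, a < d}`. [cite: ConnesConsani2016ArithmeticSite, Lemma 6.15] -/
def Dminus (l : ℝ) (d : ℕ) : Set ℚ :=
  {r | ∃ (b : ℤ) (a : ℕ), 0 < a ∧ a < d ∧ r = b / a ∧ (r : ℝ) < l}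

/-- `D_+(λ,d) := {b/a ∣ b/a > λ, a < d}`. [cite: ConnesConsani2016ArithmeticSite, Lemma 6.15] -/
def Dplus (l : ℝ) (d : ℕ) : Set ℚ :=
  {r | ∃ (b : ℤ) (a : ℕ), 0 < a ∧ a < d ∧ r = b / a ∧ l < (r : ℝ)}

/-- **Connes–Consani 2016, Lemma 6.15**: "Let `λ ∈ ℝ₊*` and `n/d` be a best rational approximation of
`λ`. Then replacing `λ` by `n/d` does not change the following sets of rational numbers
`D_-(λ,d) := {b/a ∣ b/a < λ, a < d}`, `D_+(λ,d) := {b/a ∣ b/a > λ, a < d}`." (Positivity of `λ` is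
not used.) [cite: ConnesConsani2016ArithmeticSite, Lemma 6.15] -/
theorem ConnesConsani2016_lemma_6_15 {l : ℝ} {n : ℤ} {d : ℕ} (h : IsBestApprox l n d) :
    Dminus l d = Dminus ((n : ℝ) / d) d ∧ Dplus l d = Dplus ((n : ℝ) / d) d := by
  have cast : ∀ (b : ℤ) (a : ℕ), (((b / a : ℚ)) : ℝ) = (b : ℝ) / a := fun b a => by
    rw [Rat.cast_div, Rat.cast_intCast, Rat.cast_natCast]
  constructor <;> ext r <;> constructor <;> rintro ⟨b, a, ha, had, rfl, hr⟩ <;>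
    refine ⟨b, a, ha, had, rfl, ?_⟩ <;> rw [cast] at hr ⊢
  · exact (h.lt_iff ha had b).1.1 hr
  · exact (h.lt_iff ha had b).1.2 hr
  · exact (h.lt_iff ha had b).2.1 hr
  · exact (h.lt_iff ha had b).2.2 hr

/-! ## Prop. 6.16: the congruence `𝒞_λ` on a finite set is that of a good rational approximation -/

/-- Multiplied-out form of Lemma 6.15: for `0 < e < d` and `c ∈ ℤ`, the comparison of `eλ` with `c`
is unaffected when `λ` is replaced by `n/d`. [cite: ConnesConsani2016ArithmeticSite, Prop. 6.16 (proof: "the comparison of `(a-a')λ` with `b'-b` is unaffected")] -/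
theorem IsBestApprox.mul_lt_iff {l : ℝ} {n : ℤ} {d : ℕ} (h : IsBestApprox l n d) {e : ℕ} (he : 0 < e)
    (hed : e < d) (c : ℤ) :
    ((e : ℝ) * l < c ↔ (e : ℝ) * (n / d) < c) ∧ ((c : ℝ) < e * l ↔ (c : ℝ) < e * (n / d)) := by
  have he' : (0 : ℝ) < e := by exact_mod_cast he
  obtain ⟨h1, h2⟩ := h.lt_iff he hed c
  have A : (c : ℝ) / e < l ↔ (c : ℝ) < e * l := by rw [div_lt_iff₀ he', mul_comm]
  have B : (c : ℝ) / e < n / d ↔ (c : ℝ) < e * (n / d) := by rw [div_lt_iff₀ he', mul_comm]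
  have C : l < c / e ↔ (e : ℝ) * l < c := by rw [lt_div_iff₀ he', mul_comm]
  have D : (n : ℝ) / d < c / e ↔ (e : ℝ) * (n / d) < c := by rw [lt_div_iff₀ he', mul_comm]
  exact ⟨by rw [← C, ← D]; exact h2, by rw [← A, ← B]; exact h1⟩

/-- "for any […] integers `a, a', b, b'` with [`|a - a'| < d`], one has
`aλ + b < a'λ + b' ⟺ a n/d + b < a' n/d + b'`." [cite: ConnesConsani2016ArithmeticSite, Prop. 6.16 (proof)] -/
theorem IsBestApprox.cmp_iff {l : ℝ} {n : ℤ} {d : ℕ} (h : IsBestApprox l n d) {a a' b b' : ℤ}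
    (hd₁ : a - a' < d) (hd₂ : a' - a < d) :
    (l * a + b < l * a' + b' ↔ (n : ℝ) / d * a + b < (n : ℝ) / d * a' + b') := by
  rcases lt_trichotomy a a' with hlt | rfl | hgt
  · obtain ⟨e, he0, he⟩ : ∃ e : ℕ, 0 < e ∧ (e : ℤ) = a' - a := ⟨(a' - a).toNat, by omega, by omega⟩
    have hed : e < d := by omega
    have key := (h.mul_lt_iff he0 hed (b - b')).2
    have hecast : ((e : ℕ) : ℝ) = (a' : ℝ) - a := by exact_mod_cast he
    push_cast at key
    rw [hecast] at key
    constructor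
    · intro H; have := key.1 (by linarith); linarith
    · intro H; have := key.2 (by linarith); linarith
  · constructor <;> intro H <;> linarith
  · obtain ⟨e, he0, he⟩ : ∃ e : ℕ, 0 < e ∧ (e : ℤ) = a - a' := ⟨(a - a').toNat, by omega, by omega⟩
    have hed : e < d := by omega
    have key := (h.mul_lt_iff he0 hed (b' - b)).1
    have hecast : ((e : ℕ) : ℝ) = (a : ℝ) - a' := by exact_mod_cast he
    push_cast at key
    rw [hecast] at key
    constructor
    · intro H; have := key.1 (by linarith); linarith
    · intro H; have := key.2 (by linarith); linarith

/-- Transfer of `inf`-equalities along order-equivalent functions (one direction): if `f₁` and `f₂`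
compare alike on `G ∪ G'`, then `inf_G f₁ = inf_{G'} f₁ ⟹ inf_G f₂ = inf_{G'} f₂`.
[cite: ConnesConsani2016ArithmeticSite, Prop. 6.16 (proof: "the equality `inf(λn_i + m_i) = inf(λr_i + s_i)` is unaffected if one replaces `λ` by `n/d`")] -/
theorem inf'_eq_inf'_of_cmp {ι : Type*} [DecidableEq ι] {G G' : Finset ι} (hG : G.Nonempty) (hG' : G'.Nonempty)
    {f₁ f₂ : ι → ℝ} (hcmp : ∀ g ∈ G ∪ G', ∀ g' ∈ G ∪ G', (f₁ g < f₁ g' ↔ f₂ g < f₂ g'))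
    (h : G.inf' hG f₁ = G'.inf' hG' f₁) : G.inf' hG f₂ = G'.inf' hG' f₂ := by
  obtain ⟨g, hg, hgeq⟩ := Finset.exists_mem_eq_inf' hG f₁
  obtain ⟨g', hg', hg'eq⟩ := Finset.exists_mem_eq_inf' hG' f₁
  have hgU : g ∈ G ∪ G' := Finset.mem_union_left _ hg
  have hg'U : g' ∈ G ∪ G' := Finset.mem_union_right _ hg'
  have h1 : G.inf' hG f₂ = f₂ g := by
    refine le_antisymm (Finset.inf'_le _ hg) (Finset.le_inf' _ _ fun x hx => ?_)
    by_contra hlt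
    push Not at hlt
    have h3 := (hcmp x (Finset.mem_union_left _ hx) g hgU).2 hlt
    have h4 := Finset.inf'_le f₁ hx
    rw [hgeq] at h4
    exact absurd h3 (not_lt.2 h4)
  have h2 : G'.inf' hG' f₂ = f₂ g' := by
    refine le_antisymm (Finset.inf'_le _ hg') (Finset.le_inf' _ _ fun x hx => ?_)
    by_contra hlt
    push Not at hlt
    have h3 := (hcmp x (Finset.mem_union_right _ hx) g' hg'U).2 hlt
    have h4 := Finset.inf'_le f₁ hx
    rw [hg'eq] at h4
    exact absurd h3 (not_lt.2 h4)
  rw [h1, h2]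
  have e1 : f₁ g = f₁ g' := by rw [← hgeq, ← hg'eq]; exact h
  rcases lt_trichotomy (f₂ g) (f₂ g') with hlt | heq | hgt
  · have := (hcmp g hgU g' hg'U).2 hlt
    rw [e1] at this
    exact absurd this (lt_irrefl _)
  · exact heq
  · have := (hcmp g' hg'U g hgU).2 hgt
    rw [e1] at this
    exact absurd this (lt_irrefl _)

/-- Two-sided transfer of `inf`-equalities along order-equivalent functions.
[cite: ConnesConsani2016ArithmeticSite, Prop. 6.16 (proof)] -/
theorem inf'_eq_inf'_iff_of_cmp {ι : Type*} [DecidableEq ι] {G G' : Finset ι} (hG : G.Nonempty) (hG' : G'.Nonempty)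
    {f₁ f₂ : ι → ℝ} (hcmp : ∀ g ∈ G ∪ G', ∀ g' ∈ G ∪ G', (f₁ g < f₁ g' ↔ f₂ g < f₂ g')) :
    G.inf' hG f₁ = G'.inf' hG' f₁ ↔ G.inf' hG f₂ = G'.inf' hG' f₂ :=
  ⟨inf'_eq_inf'_of_cmp hG hG' hcmp,
    inf'_eq_inf'_of_cmp hG hG' fun g hg g' hg' => (hcmp g hg g' hg').symm⟩

/-- `μ ∘ Fr_{n,m}(x) = μ ∘ Fr_{n,m}(y) ⟺ ℱ(n/m,q)(x) = ℱ(n/m,q)(y)` (`m ≥ 1`): the congruence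
`𝒞_1 ∘ Fr_{n,m}` is `𝒞_{n/m}` (Prop. 6.12 (iii)). [cite: ConnesConsani2016ArithmeticSite, Prop. 6.16 and eq. (64)] -/
theorem mu_frobNM_eq_iff (n m : ℕ) (hm : 0 < m) (x y : SubZ2) :
    mu (frobNM n m x) = mu (frobNM n m y) ↔
      frobF ((n : ℝ) / m) (by positivity) x = frobF ((n : ℝ) / m) (by positivity) y := by
  have e := fun X => congrArg (fun φ : SubZ2 →+* 𝕋 => φ X) (ConnesConsani2016_prop_6_12_iii n m hm)
  simp only [RingHom.comp_apply] at e
  constructor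
  · intro h
    have h' := congrArg zminToT h
    rw [e, e] at h'
    exact frob_injective (by exact_mod_cast hm) h'
  · intro h
    apply zminToT_injective
    rw [e, e, h]

/-- The core of Prop. 6.16: if `n/d` is a best rational approximation of `λ ≥ 0` with `d` exceeding
all differences of first exponents of the canonical decompositions of `x` and `y`, then
`ℱ(λ,q)(x) = ℱ(λ,q)(y) ⟺ ℱ(n/d,q)(x) = ℱ(n/d,q)(y)`. (The printed reduction to `x, y ∈ ℕ̄ ⊗_𝔹 ℕ̄⁺`
with `d > sup{n_i, r_i}` is replaced by the difference bound, which is what the argument uses.)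
[cite: ConnesConsani2016ArithmeticSite, Prop. 6.16 (proof)] -/
theorem frobF_eq_iff_of_isBestApprox {l : ℝ} (hl : 0 ≤ l) {n : ℤ} {d : ℕ} (h : IsBestApprox l n d)
    {r : ℝ} (hr : r = n / d) (hr0 : 0 ≤ r) (x y : SubZ2)
    (hd : ∀ g ∈ x.minGens ∪ y.minGens, ∀ g' ∈ x.minGens ∪ y.minGens, g.1 - g'.1 < d) :
    frobF l hl x = frobF l hl y ↔ frobF r hr0 x = frobF r hr0 y := by
  subst hr
  by_cases hx : x = 0
  · subst hx
    rw [map_zero, map_zero, eq_comm, frobF_eq_zero_iff, eq_comm (a := (0 : 𝕋)), frobF_eq_zero_iff]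
  by_cases hy : y = 0
  · subst hy
    rw [map_zero, map_zero, frobF_eq_zero_iff, frobF_eq_zero_iff]
  rw [frobF_eq_texp l hl hx, frobF_eq_texp l hl hy, frobF_eq_texp _ hr0 hx, frobF_eq_texp _ hr0 hy,
    texp_inj, texp_inj]
  unfold frobExp
  exact inf'_eq_inf'_iff_of_cmp (minGens_nonempty hx) (minGens_nonempty hy) fun g hg g' hg' =>
    h.cmp_iff (hd g hg g' hg') (hd g' hg' g hg)

/-- **Connes–Consani 2016, Prop. 6.16** (quantitative form of the printed proof): "Let `λ ∈ ℝ₊*` be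
irrational and `x, y ∈ ℤ_min ⊗_𝔹 ℤ_min`. Then one has `ℱ(λ,q)(x) = ℱ(λ,q)(y)` if and only if for all
sufficiently good approximations `n/m ∼ λ` one has `μ ∘ Fr_{n,m}(x) = μ ∘ Fr_{n,m}(y)` where
`μ : ℤ_min ⊗_𝔹 ℤ_min → ℤ_min` is the semiring multiplication." Here: there is `d₀` (depending on
`x, y`) such that for every best rational approximation `n/d` of `λ` with `d > d₀`,
`ℱ(λ,q)(x) = ℱ(λ,q)(y) ⟺ μ ∘ Fr_{n,d}(x) = μ ∘ Fr_{n,d}(y)` (irrationality is only needed for the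
existence of such approximations, `exists_isBestApprox_nat`). [cite: ConnesConsani2016ArithmeticSite, Prop. 6.16] -/
theorem ConnesConsani2016_prop_6_16 {l : ℝ} (hl : 0 ≤ l) (x y : SubZ2) :
    ∃ d₀ : ℕ, ∀ n d : ℕ, IsBestApprox l n d → d₀ < d →
      (frobF l hl x = frobF l hl y ↔ mu (frobNM n d x) = mu (frobNM n d y)) := by
  classical
  refine ⟨2 * ∑ g ∈ x.minGens ∪ y.minGens, g.1.natAbs, fun n d h hd0 => ?_⟩
  rw [mu_frobNM_eq_iff n d h.pos x y]
  refine frobF_eq_iff_of_isBestApprox hl h (by rw [Int.cast_natCast]) _ x y fun g hg g' hg' => ?_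
  have h1 : g.1.natAbs ≤ ∑ k ∈ x.minGens ∪ y.minGens, k.1.natAbs :=
    Finset.single_le_sum (f := fun k : ℤ × ℤ => k.1.natAbs) (fun _ _ => Nat.zero_le _) hg
  have h2 : g'.1.natAbs ≤ ∑ k ∈ x.minGens ∪ y.minGens, k.1.natAbs :=
    Finset.single_le_sum (f := fun k : ℤ × ℤ => k.1.natAbs) (fun _ _ => Nat.zero_le _) hg'
  have h4 := Int.le_natAbs (a := g.1)
  have h5 : -g'.1 ≤ (g'.1.natAbs : ℤ) := by
    have := Int.le_natAbs (a := -g'.1)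
    rwa [Int.natAbs_neg] at this
  omega

/-! ### Existence of arbitrarily good best approximations of an irrational number -/

/-- The candidate approximations with denominators `1 ≤ a ≤ D`: `(a, ⌊λa⌋)` and `(a, ⌈λa⌉)`. [folklore] -/
def approxCands (l : ℝ) (D : ℕ) : Finset (ℕ × ℤ) :=
  (Finset.Icc 1 D).biUnion fun a => {(a, ⌊l * a⌋), (a, ⌈l * a⌉)}

/-- Membership in the candidate set. [folklore] -/
private theorem mem_approxCands {l : ℝ} {D : ℕ} {p : ℕ × ℤ} :
    p ∈ approxCands l D ↔ 1 ≤ p.1 ∧ p.1 ≤ D ∧ (p.2 = ⌊l * p.1⌋ ∨ p.2 = ⌈l * p.1⌉) := by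
  constructor
  · intro hp
    obtain ⟨a, ha, hpa⟩ := Finset.mem_biUnion.1 hp
    rw [Finset.mem_Icc] at ha
    rcases Finset.mem_insert.1 hpa with rfl | hpa
    · exact ⟨ha.1, ha.2, Or.inl rfl⟩
    · rw [Finset.mem_singleton] at hpa
      subst hpa
      exact ⟨ha.1, ha.2, Or.inr rfl⟩
  · rintro ⟨h1, h2, h3⟩
    refine Finset.mem_biUnion.2 ⟨p.1, Finset.mem_Icc.2 ⟨h1, h2⟩, ?_⟩
    rcases h3 with h3 | h3
    · exact Finset.mem_insert.2 (Or.inl (Prod.ext rfl h3))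
    · exact Finset.mem_insert.2 (Or.inr (Finset.mem_singleton.2 (Prod.ext rfl h3)))

/-- `|λ - c/a| = |λa - c| / a` (`a > 0`). [folklore] -/
private theorem abs_sub_div_eq (l c : ℝ) {a : ℝ} (ha : 0 < a) : |l - c / a| = |l * a - c| / a := by
  rw [eq_div_iff ha.ne', ← abs_of_pos ha, ← abs_mul, abs_of_pos ha, sub_mul, div_mul_cancel₀ c ha.ne']

/-- Any integer is at least as far from `x` as the nearer of `⌊x⌋, ⌈x⌉`. [folklore] -/
private theorem abs_floor_or_ceil_le (x : ℝ) (b : ℤ) : |x - ⌊x⌋| ≤ |x - b| ∨ |x - ⌈x⌉| ≤ |x - b| := by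
  rcases le_or_gt b ⌊x⌋ with hb | hb
  · left
    have h1 : (b : ℝ) ≤ ⌊x⌋ := by exact_mod_cast hb
    have h2 : (⌊x⌋ : ℝ) ≤ x := Int.floor_le x
    rw [abs_of_nonneg (by linarith), abs_of_nonneg (by linarith)]
    linarith
  · right
    have hb' : ⌈x⌉ ≤ b := (Int.ceil_le_floor_add_one x).trans (by omega)
    have h1 : (⌈x⌉ : ℝ) ≤ b := by exact_mod_cast hb'
    have h2 : x ≤ ⌈x⌉ := Int.le_ceil x
    rw [abs_of_nonpos (by linarith), abs_of_nonpos (by linarith)]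
    linarith

/-- An integer as close to `x` as both `⌊x⌋` and `⌈x⌉` is one of them. [folklore] -/
private theorem eq_floor_or_ceil_of_abs_le (x : ℝ) (b : ℤ) (h1 : |x - b| ≤ |x - ⌊x⌋|)
    (h2 : |x - b| ≤ |x - ⌈x⌉|) : b = ⌊x⌋ ∨ b = ⌈x⌉ := by
  by_contra H
  push Not at H
  obtain ⟨H1, H2⟩ := H
  have hf := Int.floor_le x
  have hc := Int.le_ceil x
  have hcf := Int.ceil_le_floor_add_one x
  rcases lt_or_gt_of_ne H1 with hb | hb
  · have : (b : ℝ) ≤ ⌊x⌋ - 1 := by exact_mod_cast (show b ≤ ⌊x⌋ - 1 by omega)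
    rw [abs_of_nonneg (by linarith : 0 ≤ x - b), abs_of_nonneg (by linarith : 0 ≤ x - ⌊x⌋)] at h1
    linarith
  · have : (⌈x⌉ : ℝ) + 1 ≤ b := by exact_mod_cast (show ⌈x⌉ + 1 ≤ b by omega)
    rw [abs_of_nonpos (by linarith : x - b ≤ 0), abs_of_nonpos (by linarith : x - ⌈x⌉ ≤ 0)] at h2
    linarith

/-- **Irrational numbers have best rational approximations with arbitrarily large denominators**
(so that "sufficiently good approximations `n/m ∼ λ`" exist). Construction: among the candidates
`(a, ⌊λa⌋), (a, ⌈λa⌉)`, `a ≤ D`, a closest one with least denominator (folklore; the text takes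
the existence of "sufficiently good approximations `n/m ∼ λ`" for granted).
[cite: ConnesConsani2016ArithmeticSite, Prop. 6.16 ("for all sufficiently good approximations `n/m ∼ λ`")] -/
theorem exists_isBestApprox_of_irrational {l : ℝ} (hl : Irrational l) (d₀ : ℕ) :
    ∃ (n : ℤ) (d : ℕ), IsBestApprox l n d ∧ d₀ < d := by
  classical
  -- distances to candidates are positive
  have hne : ∀ (b : ℤ) (a : ℕ), 0 < a → l ≠ b / a := fun b a ha e => by
    have := hl.ne_rational b a
    rw [Int.cast_natCast] at this
    exact this e
  have hposd : ∀ p : ℕ × ℤ, 0 < p.1 → 0 < |l - p.2 / p.1| := fun p hp =>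
    abs_pos.2 (sub_ne_zero.2 (hne p.2 p.1 hp))
  -- Step 0: the scale `δ₀` below which the denominator must exceed `d₁ := d₀ + 1`
  set d₁ := d₀ + 1 with hd₁
  have hC₁ : (approxCands l d₁).Nonempty :=
    ⟨(1, ⌊l * (1 : ℕ)⌋), mem_approxCands.2 ⟨le_rfl, by omega, Or.inl rfl⟩⟩
  set δ₀ := (approxCands l d₁).inf' hC₁ fun p => |l - p.2 / p.1| with hδ₀
  have hδ₀pos : 0 < δ₀ := by
    rw [hδ₀, Finset.lt_inf'_iff]
    intro p hp
    exact hposd p (by have := (mem_approxCands.1 hp).1; omega)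
  obtain ⟨D, hD⟩ := exists_nat_gt (max (d₁ : ℝ) (1 / δ₀))
  have hDd₁ : d₁ < D := by exact_mod_cast (le_max_left _ _).trans_lt hD
  have hDδ : 1 / δ₀ < D := (le_max_right _ _).trans_lt hD
  have hD0 : 0 < D := by omega
  have hD0' : (0 : ℝ) < D := by exact_mod_cast hD0
  -- Step 1: a closest candidate, Step 2: with least denominator
  set S := approxCands l D with hS
  have hSne : S.Nonempty := ⟨(D, ⌊l * (D : ℕ)⌋), mem_approxCands.2 ⟨hD0, le_rfl, Or.inl rfl⟩⟩
  obtain ⟨p₁, hp₁S, hp₁min⟩ := S.exists_min_image (fun p : ℕ × ℤ => |l - p.2 / p.1|) hSne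
  set T := S.filter fun p => |l - p.2 / p.1| = |l - p₁.2 / p₁.1| with hT
  have hTne : T.Nonempty := ⟨p₁, Finset.mem_filter.2 ⟨hp₁S, rfl⟩⟩
  obtain ⟨q, hqT, hqmin⟩ := T.exists_min_image Prod.fst hTne
  obtain ⟨hqS, hqdist⟩ := Finset.mem_filter.1 hqT
  obtain ⟨hq1, hqD, hqfc⟩ := mem_approxCands.1 hqS
  have hq0' : (0 : ℝ) < q.1 := by exact_mod_cast hq1
  -- `q` is at least as close as any fraction with denominator `≤ D`
  have hqle : ∀ (b : ℤ) (a : ℕ), 0 < a → a ≤ D → |l - q.2 / q.1| ≤ |l - b / a| := by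
    intro b a ha haD
    have ha' : (0 : ℝ) < a := by exact_mod_cast ha
    have hfl : |l - q.2 / q.1| ≤ |l - ⌊l * a⌋ / a| := by
      rw [hqdist]
      exact hp₁min (a, ⌊l * a⌋) (mem_approxCands.2 ⟨ha, haD, Or.inl rfl⟩)
    have hce : |l - q.2 / q.1| ≤ |l - ⌈l * a⌉ / a| := by
      rw [hqdist]
      exact hp₁min (a, ⌈l * a⌉) (mem_approxCands.2 ⟨ha, haD, Or.inr rfl⟩)
    rcases abs_floor_or_ceil_le (l * a) b with hb | hb
    · refine hfl.trans ?_
      rw [abs_sub_div_eq _ _ ha', abs_sub_div_eq _ _ ha']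
      exact div_le_div_of_nonneg_right hb ha'.le
    · refine hce.trans ?_
      rw [abs_sub_div_eq _ _ ha', abs_sub_div_eq _ _ ha']
      exact div_le_div_of_nonneg_right hb ha'.le
  refine ⟨q.2, q.1, ⟨hq1, fun b a ha haq hne' => lt_of_le_of_ne (hqle b a ha (haq.trans hqD)) ?_⟩, ?_⟩
  · -- strictness
    intro heq
    have ha' : (0 : ℝ) < a := by exact_mod_cast ha
    -- `b` is a nearest integer to `λa`, hence a candidate
    have hb : b = ⌊l * a⌋ ∨ b = ⌈l * a⌉ := by
      have hfl := hqle ⌊l * a⌋ a ha (haq.trans hqD)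
      have hce := hqle ⌈l * a⌉ a ha (haq.trans hqD)
      rw [heq, abs_sub_div_eq _ _ ha', abs_sub_div_eq _ _ ha'] at hfl hce
      exact eq_floor_or_ceil_of_abs_le (l * a) b ((div_le_div_iff_of_pos_right ha').1 hfl)
        ((div_le_div_iff_of_pos_right ha').1 hce)
    have habS : (a, b) ∈ S := mem_approxCands.2 ⟨ha, haq.trans hqD, hb⟩
    have habT : (a, b) ∈ T := Finset.mem_filter.2 ⟨habS, by rw [← hqdist]; exact heq.symm⟩
    have haq' : q.1 ≤ a := hqmin _ habT
    have hqa : a = q.1 := le_antisymm haq haq'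
    subst hqa
    have hbn : b ≠ q.2 := fun e => hne' (Prod.ext rfl e)
    -- `|λa - b| = |λa - n|` with `b ≠ n` forces `λ = (b + n)/(2a) ∈ ℚ`
    rw [abs_sub_div_eq _ _ hq0', abs_sub_div_eq _ _ hq0', div_left_inj' hq0'.ne'] at heq
    rcases abs_eq_abs.1 heq with e | e
    · exact hbn (by exact_mod_cast (by linarith : (b : ℝ) = q.2))
    · apply hl.ne_rational (b + q.2) (2 * q.1)
      push_cast
      field_simp
      linarith
  · -- Step 3: the denominator exceeds `d₀`
    by_contra hle
    push Not at hle
    have hqC₁ : q ∈ approxCands l d₁ := mem_approxCands.2 ⟨hq1, by omega, hqfc⟩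
    have h1 : δ₀ ≤ |l - q.2 / q.1| := Finset.inf'_le _ hqC₁
    have h2 : |l - q.2 / q.1| ≤ |l - ⌊l * (D : ℕ)⌋ / (D : ℕ)| := hqle _ D hD0 le_rfl
    have h3 : |l - ⌊l * (D : ℕ)⌋ / (D : ℕ)| < 1 / D := by
      rw [abs_sub_div_eq _ _ hD0', div_lt_div_iff_of_pos_right hD0', Int.self_sub_floor,
        abs_of_nonneg (Int.fract_nonneg _)]
      exact Int.fract_lt_one _
    have h4 : 1 / (D : ℝ) < δ₀ := by
      rw [div_lt_iff₀ hD0']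
      rw [div_lt_iff₀ hδ₀pos] at hDδ
      linarith
    linarith

/-- For `λ > 0` irrational: best approximations `n/d` with `n, d ∈ ℕ` and `d` as large as desired
(folklore). [cite: ConnesConsani2016ArithmeticSite, Prop. 6.16 ("for all sufficiently good approximations `n/m ∼ λ`")] -/
theorem exists_isBestApprox_nat {l : ℝ} (hl : Irrational l) (hl0 : 0 < l) (d₀ : ℕ) :
    ∃ n d : ℕ, IsBestApprox l n d ∧ d₀ < d := by
  obtain ⟨n, d, h, hd⟩ := exists_isBestApprox_of_irrational hl (max d₀ 1)
  have hd1 : 1 < d := lt_of_le_of_lt (le_max_right _ _) hd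
  have key := h.2 0 1 one_pos (by omega) (fun e => by simp only [Prod.mk.injEq] at e; omega)
  simp only [Int.cast_zero, Nat.cast_one, zero_div, sub_zero] at key
  have hn : 0 ≤ n := by
    by_contra hneg
    push Not at hneg
    have hd' : (0 : ℝ) < d := by exact_mod_cast h.pos
    have : (n : ℝ) / d < 0 := div_neg_of_neg_of_pos (by exact_mod_cast hneg) hd'
    rw [abs_of_pos hl0, abs_of_pos (by linarith)] at key
    linarith
  refine ⟨n.toNat, d, ?_, lt_of_le_of_lt (le_max_left _ _) hd⟩
  rwa [show ((n.toNat : ℕ) : ℤ) = n from Int.toNat_of_nonneg hn]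

/-- **Connes–Consani 2016, Prop. 6.16** ("if and only if for all sufficiently good approximations"):
for `λ > 0` irrational, `ℱ(λ,q)(x) = ℱ(λ,q)(y)` iff there is `d₀` such that
`μ ∘ Fr_{n,d}(x) = μ ∘ Fr_{n,d}(y)` for every best rational approximation `n/d` of `λ` with `d > d₀`.
[cite: ConnesConsani2016ArithmeticSite, Prop. 6.16] -/
theorem ConnesConsani2016_prop_6_16_iff {l : ℝ} (hl : 0 < l) (hirr : Irrational l) (x y : SubZ2) :
    frobF l hl.le x = frobF l hl.le y ↔
      ∃ d₀ : ℕ, ∀ n d : ℕ, IsBestApprox l n d → d₀ < d → mu (frobNM n d x) = mu (frobNM n d y) := by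
  obtain ⟨d₀, hd₀⟩ := ConnesConsani2016_prop_6_16 hl.le x y
  constructor
  · intro h
    exact ⟨d₀, fun n d hb hd => (hd₀ n d hb hd).1 h⟩
  · rintro ⟨d₁, hd₁⟩
    obtain ⟨n, d, hb, hd⟩ := exists_isBestApprox_nat hirr hl (max d₀ d₁)
    exact (hd₀ n d hb (lt_of_le_of_lt (le_max_left _ _) hd)).2
      (hd₁ n d hb (lt_of_le_of_lt (le_max_right _ _) hd))

/-- **Eq. (64)**: "for each `λ ∈ ℝ₊*`, not in `ℚ₊*`, the congruence relation `𝒞_λ` on `ℕ̄ ⊗_𝔹 ℕ̄`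
defined by (62) is in fact the limit of the `𝒞_r`, as the rational `r → λ` […]
`𝒞_λ = lim_{n/m → λ} 𝒞_1 ∘ Fr_{n,m}`": on any pair `x, y`, the congruence `𝒞_λ`
(`ℱ(λ,q)(x) = ℱ(λ,q)(y)`) coincides with `𝒞_{n/d}` for all sufficiently good best rational
approximations `n/d` of `λ`. [cite: ConnesConsani2016ArithmeticSite, §6.3 eq. (64)] -/
theorem ConnesConsani2016_eq_64 {l : ℝ} (hl : 0 < l) (hirr : Irrational l) (x y : SubZ2) :
    frobF l hl.le x = frobF l hl.le y ↔
      ∃ d₀ : ℕ, ∀ n d : ℕ, IsBestApprox l n d → d₀ < d →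
        frobF ((n : ℝ) / d) (by positivity) x = frobF ((n : ℝ) / d) (by positivity) y := by
  rw [ConnesConsani2016_prop_6_16_iff hl hirr x y]
  constructor <;> rintro ⟨d₀, hd₀⟩ <;> refine ⟨d₀, fun n d hb hd => ?_⟩
  · rw [← mu_frobNM_eq_iff n d hb.pos]; exact hd₀ n d hb hd
  · rw [mu_frobNM_eq_iff n d hb.pos]; exact hd₀ n d hb hd

end Literature.NumberTheory.ConnesConsani
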